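import Literature.NumberTheory.Transcendental.KZLogCalculusProofs
import Literature.NumberTheory.Transcendental.SemialgebraicLineDeriv
import Literature.NumberTheory.Transcendental.SemialgebraicRpow
import Literature.NumberTheory.Transcendental.KZSemialgebraicComplex
import HarnessLib
import HarnessLib.Audit

/-!
# SoloInformed — the smooth locus and the Jacobian of a semialgebraic map (COROLLARY NF.2, file C1)

Solo programme `solo-KontsevichZagierPeriods-informed`, session s247 (K-NF.2, file C1: toolkit for
density removal of the change-of-variables moves (2)).

A change-of-variables move `[σ, f] − [Φ(σ), g]` of the KZ calculus carries a `ℚ`-semialgebraic map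
`Φ` with a derivative `Φ' x` *within* `σ` at every point and the density equation
`f = (g ∘ Φ) · |det Φ'|`.  To trade it for one volume-preserving map
`(x, t) ↦ (Φ x, t / |det Φ'(x)|)` between the regions under the graphs (file C2) one needs, off a
null `ℚ`-semialgebraic subset of `σ`: `Φ` smooth on an open set, `Φ' = fderiv Φ` there, and the
Jacobian determinant `x ↦ det Φ'(x)` `ℚ`-semialgebraic and smooth.  This file provides exactly that:

* `soloInformed_exists_isOpen_contDiffOn_map` — **smooth locus of a semialgebraic map**: for `Φ`
  `ℚ`-semialgebraic on `σ` there is an open `ℚ`-semialgebraic `G ⊆ σ` with `Φ` `C^∞` on `G` and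
  `σ \ G` `ℚ`-semialgebraic and null (coordinatewise `KZ.exists_isOpen_contDiffOn`);
* `soloInformed_hasFDerivAt_of_hasFDerivWithinAt` — on an open `G ⊆ σ` a derivative within `σ` is
  the derivative;
* `soloInformed_isSemialgebraicFunOn_jacEntry` / `soloInformed_contDiffOn_jacEntry` — the entries
  `x ↦ (Φ' x eⱼ)ᵢ` of the Jacobian matrix are `ℚ`-semialgebraic (partial derivatives of semialgebraic
  functions, `IsSemialgebraicFunOn.fderiv_apply_single`) and smooth on `G`;
* `soloInformed_det_eq_sum_jacEntry` — Leibniz expansion of `det Φ'(x)` in the entries;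
* `soloInformed_isSemialgebraicFunOn_det` / `soloInformed_contDiffOn_det` — `x ↦ det Φ'(x)` is
  `ℚ`-semialgebraic and smooth on `G`;
* `soloInformed_exists_jacobianLocus` — everything packaged for one move.

References: Bochnak–Coste–Roy, *Real algebraic geometry* (1998), §2.9 (smooth points), Prop. 2.9.1;
Basu–Pollack–Roy (2006), §3.5; this work, `paper/nl-elimination.md` COROLLARY NF.2.
-/

noncomputable section

open scoped BigOperators ContDiff

namespace Summit.KontsevichZagierPeriods.KontsevichZagierPeriods.Theorems

open Set MeasureTheory
open Literature.ModelTheory.ExponentialFields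
open Literature.NumberTheory.Transcendental Literature.NumberTheory.Transcendental.KZ

variable {n m : ℕ}

/-! ### Finite intersections of semialgebraic sets -/

/-- A finite intersection of `ℚ`-semialgebraic sets (over a `Finset`) is `ℚ`-semialgebraic.
[BCR 1998, §2.2] -/
theorem soloInformed_isSemialgebraic_biInter_finset {ι : Type*} (t : Finset ι)
    {S : ι → Set (Fin n → ℝ)} (hS : ∀ i ∈ t, IsSemialgebraic ℚ (S i)) :
    IsSemialgebraic ℚ (⋂ i ∈ t, S i) := by
  classical
  induction t using Finset.induction_on with
  | empty => simp [isSemialgebraic_univ]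
  | insert a t ha ih =>
    rw [Finset.set_biInter_insert]
    exact (hS a (Finset.mem_insert_self a t)).inter (ih fun i hi => hS i (Finset.mem_insert_of_mem hi))

/-! ### The smooth locus of a semialgebraic map -/

/-- **Smooth locus of a semialgebraic map.** For `Φ : ℝⁿ → ℝᵐ` `ℚ`-semialgebraic on a
`ℚ`-semialgebraic `σ` there is an open `ℚ`-semialgebraic `G ⊆ σ` on which `Φ` is `C^∞`, with `σ \ G`
`ℚ`-semialgebraic and Lebesgue-null (intersect the interior of `σ` with the smooth loci of the
coordinate functions, `KZ.exists_isOpen_contDiffOn`; the frontier of `σ` is null).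
[BCR 1998, §2.9; folklore] -/
theorem soloInformed_exists_isOpen_contDiffOn_map {σ : Set (Fin n → ℝ)}
    {Φ : (Fin n → ℝ) → (Fin m → ℝ)} (hσ : IsSemialgebraic ℚ σ) (hΦ : IsSemialgebraicMapOn ℚ σ Φ) :
    ∃ G : Set (Fin n → ℝ), G ⊆ σ ∧ IsOpen G ∧ IsSemialgebraic ℚ G ∧ ContDiffOn ℝ ∞ Φ G ∧
      IsSemialgebraic ℚ (σ \ G) ∧ volume (σ \ G) = 0 := by
  have hcoord : ∀ j, IsSemialgebraicFunOn ℚ σ (fun x => Φ x j) :=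
    (isSemialgebraicMapOn_iff_forall_holds hσ).mp hΦ
  choose Gj hGjσ hGjo hGjsa hGjsm hGjdiff hGjnull using fun j => exists_isOpen_contDiffOn hσ (hcoord j)
  refine ⟨interior σ ∩ ⋂ j ∈ (Finset.univ : Finset (Fin m)), Gj j,
    fun x hx => interior_subset hx.1, ?_, ?_, ?_, ?_, ?_⟩
  · exact isOpen_interior.inter (isOpen_biInter_finset fun j _ => hGjo j)
  · exact (isSemialgebraic_interior hσ).inter
      (soloInformed_isSemialgebraic_biInter_finset _ fun j _ => hGjsa j)
  · refine contDiffOn_pi.2 fun j => (hGjsm j).mono fun x hx => ?_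
    exact (mem_iInter₂.mp hx.2) j (Finset.mem_univ j)
  · exact hσ.diff ((isSemialgebraic_interior hσ).inter
      (soloInformed_isSemialgebraic_biInter_finset _ fun j _ => hGjsa j))
  · have hsub : σ \ (interior σ ∩ ⋂ j ∈ (Finset.univ : Finset (Fin m)), Gj j) ⊆
        frontier σ ∪ ⋃ j, (σ \ Gj j) := by
      intro x hx
      by_cases hxi : x ∈ interior σ
      · have : x ∉ ⋂ j ∈ (Finset.univ : Finset (Fin m)), Gj j := fun h => hx.2 ⟨hxi, h⟩
        rw [mem_iInter₂] at this
        push Not at this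
        obtain ⟨j, -, hj⟩ := this
        exact Or.inr (mem_iUnion.mpr ⟨j, hx.1, hj⟩)
      · exact Or.inl ⟨subset_closure hx.1, hxi⟩
    exact measure_mono_null hsub (measure_union_null (volume_frontier_eq_zero_of_isSemialgebraic hσ)
      (measure_iUnion_null fun j => hGjnull j))

/-- On an open `G ⊆ σ`, a derivative within `σ` is a (Fréchet) derivative. [folklore] -/
theorem soloInformed_hasFDerivAt_of_hasFDerivWithinAt {σ G : Set (Fin n → ℝ)}
    {Φ : (Fin n → ℝ) → (Fin m → ℝ)} {Φ' : (Fin n → ℝ) → (Fin n → ℝ) →L[ℝ] (Fin m → ℝ)}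
    (hd : ∀ x ∈ σ, HasFDerivWithinAt Φ (Φ' x) σ x) (hGσ : G ⊆ σ) (hGo : IsOpen G) {x : Fin n → ℝ}
    (hx : x ∈ G) : HasFDerivAt Φ (Φ' x) x :=
  (hd x (hGσ hx)).hasFDerivAt (Filter.mem_of_superset (hGo.mem_nhds hx) hGσ)

/-- On an open `G ⊆ σ`, `fderiv ℝ Φ = Φ'` for a derivative `Φ'` within `σ`. [folklore] -/
theorem soloInformed_fderiv_eq_of_hasFDerivWithinAt {σ G : Set (Fin n → ℝ)}
    {Φ : (Fin n → ℝ) → (Fin m → ℝ)} {Φ' : (Fin n → ℝ) → (Fin n → ℝ) →L[ℝ] (Fin m → ℝ)}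
    (hd : ∀ x ∈ σ, HasFDerivWithinAt Φ (Φ' x) σ x) (hGσ : G ⊆ σ) (hGo : IsOpen G) {x : Fin n → ℝ}
    (hx : x ∈ G) : fderiv ℝ Φ x = Φ' x :=
  (soloInformed_hasFDerivAt_of_hasFDerivWithinAt hd hGσ hGo hx).fderiv

/-! ### The entries of the Jacobian matrix -/

/-- The `(i, j)` entry `x ↦ (Φ' x eⱼ)ᵢ` of the Jacobian matrix of the derivative field `Φ'`.
[BCR 1998, §2.9] -/
def soloInformedJacEntry (Φ' : (Fin n → ℝ) → (Fin n → ℝ) →L[ℝ] (Fin m → ℝ)) (i : Fin m) (j : Fin n)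
    (x : Fin n → ℝ) : ℝ :=
  Φ' x (Pi.single j 1) i

/-- The Jacobian entry is the partial derivative `∂ⱼ Φᵢ` wherever `Φ'` is the derivative. [folklore] -/
theorem soloInformed_jacEntry_eq_fderiv {Φ : (Fin n → ℝ) → (Fin m → ℝ)}
    {Φ' : (Fin n → ℝ) → (Fin n → ℝ) →L[ℝ] (Fin m → ℝ)} {x : Fin n → ℝ} (hx : HasFDerivAt Φ (Φ' x) x)
    (i : Fin m) (j : Fin n) :
    soloInformedJacEntry Φ' i j x = fderiv ℝ (fun y => Φ y i) x (Pi.single j 1) := by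
  have hi : HasFDerivAt (fun y => Φ y i) ((ContinuousLinearMap.proj i).comp (Φ' x)) x :=
    (hasFDerivAt_pi'.mp hx) i
  rw [hi.fderiv]
  rfl

/-- **Jacobian entries are semialgebraic**: on an open `ℚ`-semialgebraic `G ⊆ σ` where `Φ` is
differentiable with derivative `Φ'`, each entry `x ↦ (Φ' x eⱼ)ᵢ` is `ℚ`-semialgebraic (partial
derivatives of semialgebraic functions are semialgebraic). [BPR 2006, Prop. 3.22; BCR 1998, §2.9] -/
theorem soloInformed_isSemialgebraicFunOn_jacEntry {σ G : Set (Fin n → ℝ)}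
    {Φ : (Fin n → ℝ) → (Fin m → ℝ)} {Φ' : (Fin n → ℝ) → (Fin n → ℝ) →L[ℝ] (Fin m → ℝ)}
    (hσ : IsSemialgebraic ℚ σ) (hΦ : IsSemialgebraicMapOn ℚ σ Φ)
    (hd : ∀ x ∈ σ, HasFDerivWithinAt Φ (Φ' x) σ x) (hGσ : G ⊆ σ) (hGo : IsOpen G)
    (hGsa : IsSemialgebraic ℚ G) (i : Fin m) (j : Fin n) :
    IsSemialgebraicFunOn ℚ G (soloInformedJacEntry Φ' i j) := by
  have hcoord : IsSemialgebraicFunOn ℚ G (fun x => Φ x i) :=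
    ((isSemialgebraicMapOn_iff_forall_holds hσ).mp hΦ i).mono hGσ hGsa
  have hdiff : ∀ x ∈ G, DifferentiableAt ℝ (fun y => Φ y i) x := fun x hx =>
    ((hasFDerivAt_pi'.mp (soloInformed_hasFDerivAt_of_hasFDerivWithinAt hd hGσ hGo hx)) i)
      |>.differentiableAt
  exact (IsSemialgebraicFunOn.fderiv_apply_single hGo hcoord hdiff j).congr fun x hx =>
    (soloInformed_jacEntry_eq_fderiv (soloInformed_hasFDerivAt_of_hasFDerivWithinAt hd hGσ hGo hx)
      i j).symm

/-- **Jacobian entries are smooth on the smooth locus**: if `Φ` is `C^∞` on an open `G ⊆ σ` with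
derivative `Φ'` within `σ`, each entry `x ↦ (Φ' x eⱼ)ᵢ` is `C^∞` on `G`. [folklore] -/
theorem soloInformed_contDiffOn_jacEntry {σ G : Set (Fin n → ℝ)}
    {Φ : (Fin n → ℝ) → (Fin m → ℝ)} {Φ' : (Fin n → ℝ) → (Fin n → ℝ) →L[ℝ] (Fin m → ℝ)}
    (hd : ∀ x ∈ σ, HasFDerivWithinAt Φ (Φ' x) σ x) (hGσ : G ⊆ σ) (hGo : IsOpen G)
    (hsm : ContDiffOn ℝ ∞ Φ G) (i : Fin m) (j : Fin n) :
    ContDiffOn ℝ ∞ (soloInformedJacEntry Φ' i j) G := by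
  have h1 : ContDiffOn ℝ ∞ (fderiv ℝ Φ) G :=
    hsm.fderiv_of_isOpen hGo (by simp)
  have h2 : ContDiffOn ℝ ∞ (fun x => fderiv ℝ Φ x (Pi.single j 1)) G :=
    h1.clm_apply contDiffOn_const
  have h3 : ContDiffOn ℝ ∞ (fun x => fderiv ℝ Φ x (Pi.single j 1) i) G :=
    (contDiffOn_pi.1 h2) i
  refine h3.congr fun x hx => ?_
  simp only [soloInformedJacEntry, soloInformed_fderiv_eq_of_hasFDerivWithinAt hd hGσ hGo hx]

/-! ### The Jacobian determinant -/

/-- **Leibniz expansion of the Jacobian determinant** in the entries: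
`det Φ'(x) = ∑_τ sign τ · ∏ᵢ (Φ' x eᵢ)_{τ i}`. [folklore] -/
theorem soloInformed_det_eq_sum_jacEntry (Φ' : (Fin n → ℝ) → (Fin n → ℝ) →L[ℝ] (Fin n → ℝ))
    (x : Fin n → ℝ) :
    (Φ' x).det = ∑ τ : Equiv.Perm (Fin n), ((Equiv.Perm.sign τ : ℤ) : ℝ) *
      ∏ i, soloInformedJacEntry Φ' (τ i) i x := by
  have h1 : (Φ' x).det = LinearMap.det (Φ' x : (Fin n → ℝ) →ₗ[ℝ] (Fin n → ℝ)) := rfl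
  rw [h1, ← LinearMap.det_toMatrix', Matrix.det_apply']
  refine Finset.sum_congr rfl fun τ _ => ?_
  simp only [soloInformedJacEntry, LinearMap.toMatrix'_apply, ContinuousLinearMap.coe_coe]

/-- **The Jacobian determinant is semialgebraic** on an open `ℚ`-semialgebraic `G ⊆ σ` where `Φ'`
is the derivative of the `ℚ`-semialgebraic map `Φ`. [BCR 1998, §2.9; this work] -/
theorem soloInformed_isSemialgebraicFunOn_det {σ G : Set (Fin n → ℝ)}
    {Φ : (Fin n → ℝ) → (Fin n → ℝ)} {Φ' : (Fin n → ℝ) → (Fin n → ℝ) →L[ℝ] (Fin n → ℝ)}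
    (hσ : IsSemialgebraic ℚ σ) (hΦ : IsSemialgebraicMapOn ℚ σ Φ)
    (hd : ∀ x ∈ σ, HasFDerivWithinAt Φ (Φ' x) σ x) (hGσ : G ⊆ σ) (hGo : IsOpen G)
    (hGsa : IsSemialgebraic ℚ G) : IsSemialgebraicFunOn ℚ G (fun x => (Φ' x).det) := by
  have h : IsSemialgebraicFunOn ℚ G (fun x => ∑ τ : Equiv.Perm (Fin n),
      ((Equiv.Perm.sign τ : ℤ) : ℝ) * ∏ i, soloInformedJacEntry Φ' (τ i) i x) := by
    refine isSemialgebraicFunOn_finset_sum _ hGsa fun τ _ => ?_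
    have hc : IsSemialgebraicFunOn ℚ G (fun _ => (((Equiv.Perm.sign τ : ℤ) : ℚ) : ℝ)) := by
      simpa using isSemialgebraicFunOn_ratCast hGsa ((Equiv.Perm.sign τ : ℤ) : ℚ)
    have hp : IsSemialgebraicFunOn ℚ G (fun x => ∏ i, soloInformedJacEntry Φ' (τ i) i x) :=
      IsSemialgebraicFunOn.finset_prod hGsa _ fun i _ =>
        soloInformed_isSemialgebraicFunOn_jacEntry hσ hΦ hd hGσ hGo hGsa (τ i) i
    exact (IsSemialgebraicFunOn.mul_holds hc hp).congr fun x _ => by simp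
  exact h.congr fun x _ => (soloInformed_det_eq_sum_jacEntry Φ' x).symm

/-- **The Jacobian determinant is smooth on the smooth locus.** [folklore] -/
theorem soloInformed_contDiffOn_det {σ G : Set (Fin n → ℝ)}
    {Φ : (Fin n → ℝ) → (Fin n → ℝ)} {Φ' : (Fin n → ℝ) → (Fin n → ℝ) →L[ℝ] (Fin n → ℝ)}
    (hd : ∀ x ∈ σ, HasFDerivWithinAt Φ (Φ' x) σ x) (hGσ : G ⊆ σ) (hGo : IsOpen G)
    (hsm : ContDiffOn ℝ ∞ Φ G) : ContDiffOn ℝ ∞ (fun x => (Φ' x).det) G := by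
  have h : ContDiffOn ℝ ∞ (fun x => ∑ τ : Equiv.Perm (Fin n),
      ((Equiv.Perm.sign τ : ℤ) : ℝ) * ∏ i, soloInformedJacEntry Φ' (τ i) i x) G := by
    refine ContDiffOn.sum fun τ _ => contDiffOn_const.mul ?_
    exact contDiffOn_prod fun i _ => soloInformed_contDiffOn_jacEntry hd hGσ hGo hsm (τ i) i
  exact h.congr fun x _ => soloInformed_det_eq_sum_jacEntry Φ' x

/-- The absolute Jacobian determinant `x ↦ |det Φ'(x)|` is `ℚ`-semialgebraic on `G`. [this work] -/
theorem soloInformed_isSemialgebraicFunOn_absDet {σ G : Set (Fin n → ℝ)}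
    {Φ : (Fin n → ℝ) → (Fin n → ℝ)} {Φ' : (Fin n → ℝ) → (Fin n → ℝ) →L[ℝ] (Fin n → ℝ)}
    (hσ : IsSemialgebraic ℚ σ) (hΦ : IsSemialgebraicMapOn ℚ σ Φ)
    (hd : ∀ x ∈ σ, HasFDerivWithinAt Φ (Φ' x) σ x) (hGσ : G ⊆ σ) (hGo : IsOpen G)
    (hGsa : IsSemialgebraic ℚ G) : IsSemialgebraicFunOn ℚ G (fun x => |(Φ' x).det|) :=
  (soloInformed_isSemialgebraicFunOn_det hσ hΦ hd hGσ hGo hGsa).abs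

/-- The absolute Jacobian determinant is smooth on the part of the smooth locus where it does not
vanish. [folklore] -/
theorem soloInformed_contDiffOn_absDet {σ G : Set (Fin n → ℝ)}
    {Φ : (Fin n → ℝ) → (Fin n → ℝ)} {Φ' : (Fin n → ℝ) → (Fin n → ℝ) →L[ℝ] (Fin n → ℝ)}
    (hd : ∀ x ∈ σ, HasFDerivWithinAt Φ (Φ' x) σ x) (hGσ : G ⊆ σ) (hGo : IsOpen G)
    (hsm : ContDiffOn ℝ ∞ Φ G) :
    ContDiffOn ℝ ∞ (fun x => |(Φ' x).det|) {x ∈ G | (Φ' x).det ≠ 0} := by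
  intro x hx
  have h1 : ContDiffAt ℝ ∞ (fun x => (Φ' x).det) x :=
    (soloInformed_contDiffOn_det hd hGσ hGo hsm).contDiffAt (hGo.mem_nhds hx.1)
  have hc : ContinuousAt (fun x => (Φ' x).det) x := h1.continuousAt
  rcases lt_or_gt_of_ne hx.2 with hneg | hpos
  · have hev : ∀ᶠ y in nhds x, (Φ' y).det < 0 := hc.preimage_mem_nhds (Iio_mem_nhds hneg)
    have heq : (fun y => |(Φ' y).det|) =ᶠ[nhds x] fun y => -(Φ' y).det :=
      hev.mono fun y hy => abs_of_neg hy
    exact (h1.neg.congr_of_eventuallyEq heq).contDiffWithinAt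
  · have hev : ∀ᶠ y in nhds x, 0 < (Φ' y).det := hc.preimage_mem_nhds (Ioi_mem_nhds hpos)
    have heq : (fun y => |(Φ' y).det|) =ᶠ[nhds x] fun y => (Φ' y).det :=
      hev.mono fun y hy => abs_of_pos hy
    exact (h1.congr_of_eventuallyEq heq).contDiffWithinAt

/-- The non-degenerate part `{x ∈ G | det Φ'(x) ≠ 0}` of the smooth locus is open. [folklore] -/
theorem soloInformed_isOpen_sep_det_ne_zero {σ G : Set (Fin n → ℝ)}
    {Φ : (Fin n → ℝ) → (Fin n → ℝ)} {Φ' : (Fin n → ℝ) → (Fin n → ℝ) →L[ℝ] (Fin n → ℝ)}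
    (hd : ∀ x ∈ σ, HasFDerivWithinAt Φ (Φ' x) σ x) (hGσ : G ⊆ σ) (hGo : IsOpen G)
    (hsm : ContDiffOn ℝ ∞ Φ G) : IsOpen {x ∈ G | (Φ' x).det ≠ 0} :=
  (soloInformed_contDiffOn_det hd hGσ hGo hsm).continuousOn.isOpen_inter_preimage hGo
    isOpen_ne

/-- The non-degenerate part `{x ∈ G | det Φ'(x) ≠ 0}` and the critical part
`{x ∈ G | det Φ'(x) = 0}` of the smooth locus are `ℚ`-semialgebraic. [BCR 1998, §2.2] -/
theorem soloInformed_isSemialgebraic_sep_det {σ G : Set (Fin n → ℝ)}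
    {Φ : (Fin n → ℝ) → (Fin n → ℝ)} {Φ' : (Fin n → ℝ) → (Fin n → ℝ) →L[ℝ] (Fin n → ℝ)}
    (hσ : IsSemialgebraic ℚ σ) (hΦ : IsSemialgebraicMapOn ℚ σ Φ)
    (hd : ∀ x ∈ σ, HasFDerivWithinAt Φ (Φ' x) σ x) (hGσ : G ⊆ σ) (hGo : IsOpen G)
    (hGsa : IsSemialgebraic ℚ G) :
    IsSemialgebraic ℚ {x ∈ G | (Φ' x).det ≠ 0} ∧ IsSemialgebraic ℚ {x ∈ G | (Φ' x).det = 0} := by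
  have hD := soloInformed_isSemialgebraicFunOn_det hσ hΦ hd hGσ hGo hGsa
  have hne : {x ∈ G | (Φ' x).det ≠ 0} =
      {x | x ∈ G ∧ (Φ' x).det < 0} ∪ {x | x ∈ G ∧ (-fun x => (Φ' x).det) x < 0} := by
    ext x
    simp only [mem_setOf_eq, mem_union, Pi.neg_apply, neg_lt_zero]
    constructor
    · rintro ⟨hx, h⟩
      rcases lt_or_gt_of_ne h with h | h
      · exact Or.inl ⟨hx, h⟩
      · exact Or.inr ⟨hx, h⟩
    · rintro (⟨hx, h⟩ | ⟨hx, h⟩)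
      · exact ⟨hx, h.ne⟩
      · exact ⟨hx, h.ne'⟩
  have heq : {x ∈ G | (Φ' x).det = 0} =
      {x | x ∈ G ∧ 0 ≤ (Φ' x).det} ∩ {x | x ∈ G ∧ 0 ≤ (-fun x => (Φ' x).det) x} := by
    ext x
    simp only [mem_setOf_eq, mem_inter_iff, Pi.neg_apply, neg_nonneg]
    constructor
    · rintro ⟨hx, h⟩
      exact ⟨⟨hx, h.ge⟩, hx, h.le⟩
    · rintro ⟨⟨hx, h1⟩, -, h2⟩
      exact ⟨hx, le_antisymm h2 h1⟩
  refine ⟨?_, ?_⟩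
  · rw [hne]
    exact hD.isSemialgebraic_sep_neg.union hD.neg.isSemialgebraic_sep_neg
  · rw [heq]
    exact hD.isSemialgebraic_sep_nonneg.inter hD.neg.isSemialgebraic_sep_nonneg

/-- **The Jacobian locus of a change-of-variables move**, packaged: for `Φ : ℝⁿ → ℝⁿ`
`ℚ`-semialgebraic on `σ` with a derivative `Φ'` within `σ` everywhere on `σ`, there is an open
`ℚ`-semialgebraic `G ⊆ σ` with `σ \ G` `ℚ`-semialgebraic and null, on which `Φ` is `C^∞` with
`HasFDerivAt Φ (Φ' x) x`, and on which `x ↦ det Φ'(x)` is `ℚ`-semialgebraic and `C^∞`.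
[BCR 1998, §2.9; this work, COROLLARY NF.2 (proof, case (2))] -/
theorem soloInformed_exists_jacobianLocus {σ : Set (Fin n → ℝ)} {Φ : (Fin n → ℝ) → (Fin n → ℝ)}
    {Φ' : (Fin n → ℝ) → (Fin n → ℝ) →L[ℝ] (Fin n → ℝ)} (hσ : IsSemialgebraic ℚ σ)
    (hΦ : IsSemialgebraicMapOn ℚ σ Φ) (hd : ∀ x ∈ σ, HasFDerivWithinAt Φ (Φ' x) σ x) :
    ∃ G : Set (Fin n → ℝ), G ⊆ σ ∧ IsOpen G ∧ IsSemialgebraic ℚ G ∧ IsSemialgebraic ℚ (σ \ G) ∧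
      volume (σ \ G) = 0 ∧ ContDiffOn ℝ ∞ Φ G ∧ (∀ x ∈ G, HasFDerivAt Φ (Φ' x) x) ∧
      IsSemialgebraicFunOn ℚ G (fun x => (Φ' x).det) ∧ ContDiffOn ℝ ∞ (fun x => (Φ' x).det) G := by
  obtain ⟨G, hGσ, hGo, hGsa, hsm, hdiff, hnull⟩ := soloInformed_exists_isOpen_contDiffOn_map hσ hΦ
  exact ⟨G, hGσ, hGo, hGsa, hdiff, hnull, hsm,
    fun x hx => soloInformed_hasFDerivAt_of_hasFDerivWithinAt hd hGσ hGo hx,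
    soloInformed_isSemialgebraicFunOn_det hσ hΦ hd hGσ hGo hGsa,
    soloInformed_contDiffOn_det hd hGσ hGo hsm⟩

end Summit.KontsevichZagierPeriods.KontsevichZagierPeriods.Theorems

end
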